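import Literature.RingTheory.HilbertSamuel.NormalFlatnessLocalization
import Literature.AlgebraicGeometry.Resolution.MarkedIdealsEtale
import Literature.AlgebraicGeometry.Resolution.StalkIdealLemmas
import Literature.AlgebraicGeometry.Resolution.BlowupOffCentre
import Literature.AlgebraicGeometry.Resolution.MonomialOrderReductionUnit
import HarnessLib

/-!
# Permissibility of a centre at a point is preserved where a morphism is a local isomorphism

Topic: `Literature/AlgebraicGeometry/Resolution`. Theorem-only file (sorry-free, no definitions, no named facts).

Cossart–Jannsen–Saito's permissibility of a centre `D ⊆ X` at a point `x ∈ D` (LNM 2270, Def. 3.1 (2): `D` regular at `x`,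
`X` normally flat along `D` at `x`, `D` containing no irreducible component of `X` through `x`) is a property of the local
ring `𝒪_{X,x}` with its centre ideal (tree `Ideal.IsPermissible`, `Literature/RingTheory/HilbertSamuel/NormalFlatness.lean`),
invariant under ring isomorphisms (tree `Ideal.IsPermissible.map_ringEquiv`). The tree's blow-up sequences of
Cossart–Jannsen–Saito type (`IsBPermissibleSequenceB`, `EmbeddedResolutionExcellentSurfacesSequence.lean`) read it in the
embedded form «`(C_z + 𝓘_z)/𝓘_z` is permissible in `𝒪_{Z,z}/𝓘_z`» for an embedded `X = V(𝓘) ⊆ Z`. THIS FILE transports that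
embedded clause along a morphism `f : V → Z` at a point `v` where the stalk map `𝒪_{Z, f v} → 𝒪_{V, v}` is an ISOMORPHISM — an
open immersion, or a blowing up at a point off its centre (Stacks 02OS) — for any ideal sheaves upstairs whose stalks at `v`
are the extended stalks (e.g. the inverse images `𝓘·𝒪_V`, `C·𝒪_V`; the controlled transform of `𝓘` and the reduced ideal of
its support off the centre):

* `isPermissible_map_stalkIdeal_of_isIso_stalkMap` — **MAIN** (pure transport through `𝒪_{Z,f v}/𝓘 ≃ 𝒪_{V,v}/𝓘'`);
* `stalkIdeal_vanishingIdeal_support_eq_of_isIso_stalkMap` — reduced ideals of supports follow their ideals through the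
  stalk isomorphism (`√` commutes with isomorphisms);
* `IsBlowup.isPermissible_map_stalkIdeal_of_not_mem_support` — **for a blowing up `τ` along `P` and a point `v` with
  `τ v ∉ V(P)`: permissibility of `C` at `τ v` for the reduced zero-scheme of `D` gives permissibility of `C·𝒪` at `v` for
  the reduced zero-scheme of the controlled transform `τᶜ(D, b)`** (any weight `b`) — the clause carried across the blowing
  up of ONE piece of a disconnected centre to the remaining pieces (Bierstone–Grigoriev–Milman–Włodarczyk 2011, §4 Step 2b).

Use (res-hironaka, chain W5.2, T5-E «W₂B-maxweight», the pieces loop of the E-side transport).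

## References
* V. Cossart, U. Jannsen, S. Saito, *Desingularization: Invariants and Strategy*, LNM 2270 (2020), Def. 3.1 (2), (6.2).
  [CossartJannsenSaito2020]
* The Stacks Project, Tag 02OS. [StacksProject]
* E. Bierstone, D. Grigoriev, P. Milman, J. Włodarczyk, arXiv:1206.3090, §4 Step 2b. [BierstoneGrigorievMilmanWlodarczyk2011]
-/

noncomputable section

open CategoryTheory CategoryTheory.Limits AlgebraicGeometry TopologicalSpace IsLocalRing

namespace Literature.AlgebraicGeometry.Resolution

universe u

open Scheme.IdealSheafData

section Stalk

variable {V X : Scheme.{u}} (f : V ⟶ X)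

/-- **Permissibility at a point is transported through an isomorphism of local rings.** Let the stalk map
`𝒪_{X, f v} → 𝒪_{V, v}` be an isomorphism and let `𝓘', C'` be ideal sheaves on `V` whose stalks at `v` are the extensions of
the stalks of `𝓘, C` at `f v`. If `C` is permissible at `f v` for `V(𝓘)` (the image of `C_{f v}` in `𝒪_{X,f v}/𝓘_{f v}` is a
permissible ideal, CJS Def. 3.1 (2)), then `C'` is permissible at `v` for `V(𝓘')`.
[cite: CossartJannsenSaito2020, Def. 3.1 (2)] [cite: StacksProject, Tag 02OS] -/
theorem isPermissible_map_stalkIdeal_of_isIso_stalkMap (v : V) [IsIso (f.stalkMap v)] {𝓘 C : X.IdealSheafData}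
    {𝓘' C' : V.IdealSheafData} (h𝓘 : stalkIdeal 𝓘' v = stalkIdeal (𝓘.comap f) v)
    (hC : stalkIdeal C' v = stalkIdeal (C.comap f) v)
    (h : ((stalkIdeal C (f v)).map (Ideal.Quotient.mk (stalkIdeal 𝓘 (f v)))).IsPermissible) :
    ((stalkIdeal C' v).map (Ideal.Quotient.mk (stalkIdeal 𝓘' v))).IsPermissible := by
  let e : X.presheaf.stalk (f v) ≃+* V.presheaf.stalk v := (asIso (f.stalkMap v)).commRingCatIsoToRingEquiv
  have he : (e : X.presheaf.stalk (f v) →+* V.presheaf.stalk v) = (f.stalkMap v).hom := rfl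
  have h𝓘' : stalkIdeal 𝓘' v = (stalkIdeal 𝓘 (f v)).map (e : X.presheaf.stalk (f v) →+* V.presheaf.stalk v) := by
    rw [h𝓘, stalkIdeal_comap_eq_map, he]
  have hC'' : stalkIdeal C' v = (stalkIdeal C (f v)).map (e : X.presheaf.stalk (f v) →+* V.presheaf.stalk v) := by
    rw [hC, stalkIdeal_comap_eq_map, he]
  -- the induced isomorphism of the quotients
  let ē := Ideal.quotientEquiv (stalkIdeal 𝓘 (f v)) (stalkIdeal 𝓘' v) e h𝓘'
  have key := h.map_ringEquiv ē
  have hcomp : (ē : _ →+* _).comp (Ideal.Quotient.mk (stalkIdeal 𝓘 (f v))) =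
      (Ideal.Quotient.mk (stalkIdeal 𝓘' v)).comp (e : X.presheaf.stalk (f v) →+* V.presheaf.stalk v) := by
    ext x
    rfl
  rwa [Ideal.map_map, hcomp, ← Ideal.map_map, ← hC''] at key

/-- **Reduced ideals of supports follow their ideals through a stalk isomorphism**: if the stalk map at `v` is an
isomorphism and `D'_v = (D·𝒪_V)_v`, then `𝓘(V(D'))_v = (𝓘(V(D))·𝒪_V)_v` (both are the radicals, which commute with the
isomorphism). [cite: StacksProject, Tag 02OS] -/
theorem stalkIdeal_vanishingIdeal_support_eq_of_isIso_stalkMap (v : V) [IsIso (f.stalkMap v)] {D : X.IdealSheafData}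
    {D' : V.IdealSheafData} (hD : stalkIdeal D' v = stalkIdeal (D.comap f) v) :
    stalkIdeal (vanishingIdeal D'.support) v = stalkIdeal ((vanishingIdeal D.support).comap f) v := by
  let e : X.presheaf.stalk (f v) ≃+* V.presheaf.stalk v := (asIso (f.stalkMap v)).commRingCatIsoToRingEquiv
  have he : (e : X.presheaf.stalk (f v) →+* V.presheaf.stalk v) = (f.stalkMap v).hom := rfl
  rw [vanishingIdeal_support, vanishingIdeal_support, stalkIdeal_radical, hD, stalkIdeal_comap_eq_map,
    stalkIdeal_comap_eq_map, stalkIdeal_radical, ← he]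
  exact (Ideal.map_radical_of_surjective (f := (e : X.presheaf.stalk (f v) →+* V.presheaf.stalk v)) e.surjective
    (fun x hx => by
      rw [RingHom.mem_ker] at hx
      have hx0 : x = 0 := e.injective (by simpa using hx)
      rw [hx0]
      exact zero_mem _)).symm

/-- The same transport with the HOST clause read on reduced zero-schemes: stalk map an isomorphism at `v`, `D'_v = (D·𝒪)_v`,
`C'_v = (C·𝒪)_v`; permissibility of `C` at `f v` for `V(D)_red` gives permissibility of `C'` at `v` for `V(D')_red`.
[cite: CossartJannsenSaito2020, Def. 3.1 (2)] [cite: StacksProject, Tag 02OS] -/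
theorem isPermissible_map_stalkIdeal_vanishingIdeal_of_isIso_stalkMap (v : V) [IsIso (f.stalkMap v)]
    {D C : X.IdealSheafData} {D' C' : V.IdealSheafData} (hD : stalkIdeal D' v = stalkIdeal (D.comap f) v)
    (hC : stalkIdeal C' v = stalkIdeal (C.comap f) v)
    (h : ((stalkIdeal C (f v)).map (Ideal.Quotient.mk (stalkIdeal (vanishingIdeal D.support) (f v)))).IsPermissible) :
    ((stalkIdeal C' v).map (Ideal.Quotient.mk (stalkIdeal (vanishingIdeal D'.support) v))).IsPermissible :=
  isPermissible_map_stalkIdeal_of_isIso_stalkMap f v (stalkIdeal_vanishingIdeal_support_eq_of_isIso_stalkMap f v hD) hC h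

end Stalk

/-! ## Across a blowing up, at points off its centre -/

section Blowup

variable {W W' : Scheme.{u}} {τ : W' ⟶ W} {P : W.IdealSheafData}

/-- **Permissibility carried across the blowing up of a disjoint piece.** For a blowing up `τ` along `P`, a point `v` with
`τ v ∉ V(P)`, ideal sheaves `D` (host) and `C` (centre) on `W` and any weight `b`: if `C` is permissible at `τ v` for the
reduced zero-scheme of `D`, then `C·𝒪_{W'}` is permissible at `v` for the reduced zero-scheme of the controlled transform
`τᶜ(D, b)` — off the centre the controlled transform is the total transform and `τ` is a local isomorphism (Stacks 02OS).
The clause `hperm` of `IsBPermissibleSequenceB` for the remaining pieces of a disconnected Cossart–Jannsen–Saito centre after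
blowing up one piece (BGMW §4 Step 2b). [cite: CossartJannsenSaito2020, Def. 3.1 (2), (6.2)] [cite: StacksProject, Tag 02OS]
[cite: BierstoneGrigorievMilmanWlodarczyk2011, §4 Step 2b] -/
theorem IsBlowup.isPermissible_map_stalkIdeal_of_not_mem_support (hτ : IsBlowup τ P) {v : W'}
    (hv : τ v ∉ (P.support : Set W)) (D C : W.IdealSheafData) (b : ℕ)
    (h : ((stalkIdeal C (τ v)).map (Ideal.Quotient.mk (stalkIdeal (vanishingIdeal D.support) (τ v)))).IsPermissible) :
    ((stalkIdeal (C.comap τ) v).map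
      (Ideal.Quotient.mk (stalkIdeal (vanishingIdeal (controlledTransform τ P D b).support) v))).IsPermissible := by
  haveI := hτ.isIso_stalkMap_of_not_mem_support hv
  exact isPermissible_map_stalkIdeal_vanishingIdeal_of_isIso_stalkMap τ v
    (hτ.stalkIdeal_controlledTransform_of_not_mem D b hv) rfl h

/-- Variant with an arbitrary upstairs centre ideal `C'` having the stalk `(C·𝒪)_v` at `v` (e.g. the reduced ideal
`𝓘(τ⁻¹Z)` of the preimage of a piece `Z` disjoint from `V(P)`, tree `IsBlowup.comap_vanishingIdeal_of_disjoint`).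
[cite: CossartJannsenSaito2020, Def. 3.1 (2), (6.2)] [cite: StacksProject, Tag 02OS] -/
theorem IsBlowup.isPermissible_map_stalkIdeal_of_not_mem_support' (hτ : IsBlowup τ P) {v : W'}
    (hv : τ v ∉ (P.support : Set W)) (D C : W.IdealSheafData) (b : ℕ) {C' : W'.IdealSheafData}
    (hC : stalkIdeal C' v = stalkIdeal (C.comap τ) v)
    (h : ((stalkIdeal C (τ v)).map (Ideal.Quotient.mk (stalkIdeal (vanishingIdeal D.support) (τ v)))).IsPermissible) :
    ((stalkIdeal C' v).map
      (Ideal.Quotient.mk (stalkIdeal (vanishingIdeal (controlledTransform τ P D b).support) v))).IsPermissible := by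
  haveI := hτ.isIso_stalkMap_of_not_mem_support hv
  exact isPermissible_map_stalkIdeal_vanishingIdeal_of_isIso_stalkMap τ v
    (hτ.stalkIdeal_controlledTransform_of_not_mem D b hv) hC h

end Blowup

end Literature.AlgebraicGeometry.Resolution

end
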